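import Summits.QuantumFields.BalabanUV.T4Continuum.Support.NE7BlockDefectSymbolStencil

/-!
# NE7BlockAverageContourGauge — H-1″: the CONTOUR average of B7 (14)–(15), linearised, is the straight-stencil average
# `n·Q_k` (B5 (1.18) = `B5Block118.QvOp`) plus an EXACT COARSE PURE GAUGE; hence its coarse plaquette field, its Wilson
# deficit and the K2a abelian symbol lemma (H-1 ∕ H-1′) are those of `QvOp` BY NAME — for EVERY corner-transporter
# system (B5 (1.7) trees with the reversed last piece, B12 (0.11) permutation averages, …)

Cell `pub-balaban`, rung (B)+1 sub-cell t4, lineage `b2b-balaban-t4-ne7-p2` (CRUX PROVER NE7 #2 under the coordinator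
ruling «YM redirect», 2026-08-21; generation 51; texts `HOME/t4/b2b-balaban-t4-ne7-p2/g51/HOM-JUNCTION-NE7-P2.md` v3 §2″).
Companion of `NE7BlockDefectSymbol` (H-1 part 1), `NE7BlockDefectSymbolBound` (H-1 part 2: `0 ≤ ε†d(p)ε ≤ ((n²−1)∕12)|p|⁴|ε|²`)
and `NE7BlockDefectSymbolStencil` (H-1′: on plane waves Federbush's `T4AveragingDeficit.deficit` of `QvOp` IS that closed
form).  What H-1′ left to the cell's computation lane (balaban-calc note `NE7-P-HOM-1.md`, three codes; GRAMMAR G13 v8 (ii):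
«the (1.18) → B7 (14) step (tree-contour word = coarse pure gauge) remains this lane's three-code identification until
formalised») is formalised here.

HONEST FRAMING (T4-DAG PAGE 1).  The cell's T⁴ target is the existence AND uniqueness of the continuum limit of Bałaban's
unit-scale averaged loop expectations on a FINITE torus — NOT infinite volume, NO mass gap, NOT the Clay problem, NOT summit
progress.  This file is [folklore] lattice bookkeeping about LINEARISED ABELIAN objects on the typed torus of
`B5Prop11Plancherel`; nothing of Bałaban's NON-LINEAR average (15)∕(42), his minimisers, propagators or 𝐑-operation is
touched; NE7 is NOT printed in B1–B16 and NOT proved; spine estimates PROVED 0∕9.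
HONEST DEPENDENCY (cell, verbatim): continuum YM on T⁴ ⇐ BetaPertH ∧ nine spine estimates (0/9 proved); BetaPertH ⇐ (D1) ∧
(D4) ∧ CAP+tail; G-an2-4 gates asym, D1 and NE2/3/4.

CITATION HEADER (lean-in-tree rule 2026-08-18).  No sentence of any paper is a hypothesis; the `[cite:]` tags locate the
OBJECTS typed.  T. Bałaban, *Averaging operations for lattice gauge theories*, Commun. Math. Phys. **98** (1985) 17–51
[Balaban1985Averaging] («B7»): (14) p. 19 «`Γ_{c,x} = Γ_{c₋,x} ∪ [x, x(c)] ∪ Γ_{x(c),c₊}`», (15) p. 19 ∕ (42) p. 23 the average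
`Ū_c = exp[i Σ_{x∈B(c₋)} L^{−d} (1/i) log U(Γ_{c,x})U(c)⁻¹] U(c)`, (11) p. 19 `\bar{U^u} = Ū^u`, (47)–(48) p. 25 the
linearisation `Σ_{x∈B(c₋)} L^{−d} A(Γ_{c,x})` and the corner cancellation `Σ_{c⊂∂p′} Σ_x L^{−d} A(Γ_{c,x}) = Σ_{x∈B(y₀)} L^{−d}
A(∂(p′)_x)` (tree: `B7Prop1Explicit.Tside`, `.gammaWord` — the last piece IS `Γ_{c₊,x(c)}` reversed —, `.corner_cancellation`);
T. Bałaban, *Propagators and renormalization transformations for lattice gauge theories. I*, Commun. Math. Phys. **95** (1984)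
17–40 [Balaban1984PropagatorsI] («B5»): (1.7) p. 18 the tree contours «from `y` the `d`-th coordinate is changed first»,
(1.18) p. 20 the straight average `Q_k` = `B5Block118.QvOp` (normalisation `η^{d+1}`), (1.20) p. 20 `Q_kA^λ = Q_kA − ∂Q′_kλ` =
`B5Block118.QvOp_gaugeT_eq`; T. Bałaban, Commun. Math. Phys. **109** (1987) 249–301 [Balaban1987RG1] («B12»): (0.11)–(0.12)
p. 253–254 the permutation-averaged contour variables `𝐔(y,x)` in the same recipe (tree: `B12ContourAverage253`) — covered by
the arbitrary transporter system `T` below; P. Federbush, Commun. Math. Phys. **107** (1986) 319–329 [Federbush1986PhaseCellI]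
(0.12) p. 321 — the deficit (`T4AveragingDeficit.deficit`, `deficit_nonpos`).
[cite: Balaban1985Averaging, (11), (14)–(15) p. 19, (42) p. 23, (47)–(48) p. 25; Balaban1984PropagatorsI, (1.7) p. 18, (1.18),
(1.20) p. 20; Balaban1987RG1, (0.11)–(0.12) pp. 253–254; Federbush1986PhaseCellI, (0.12) p. 321 (objects ∕ context only)]

WHAT IS TYPED AND PROVED (all [folklore], 0 sorry; `n ≥ 1` the block side, coarse torus `Π_μ ℤ∕M_μ`, fine torus `Π_μ ℤ∕nM_μ`,
`x_j = bpt y j = n·y + j` the block points, `A([x, x+e_μ]) = lineSum A x μ`).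
§1 CONTOUR AVERAGES WITH ARBITRARY CORNER DATA.  For corner data `T : (coarse site y) → (block digit j) → ℂ` — the
linearised transporters «`A(Γ_{y, x_j})`» of ANY contour system attached to the block corners, translated with the block —
the linearised contour average with B7's normalisation `L^{−d}`,
`QconOp T A (y, μ) = n^{−d} Σ_j [T y j + A([x_j, x_j + e_μ]) − T (y + e_μ) j]`                                 (`QconOp`)
(the three pieces of (14): corner-to-`x`, the straight line, and `Γ_{x(c),c₊}` = the REVERSED corner contour of the NEXT
block), and the corner potential `cornerPot T y = n^{−d} Σ_j T y j`.  THEN: `QconOp_eq` — `QconOp T A (y,μ) = n·(Q_kA)(y,μ) −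
(cornerPot T (y+e_μ) − cornerPot T y)`; `QconOp_eq_gaugeT` — `QconOp T A = (n·Q_kA)^{Φ}`, `Φ = cornerPot T`, a COARSE GAUGE
TRANSFORM (`B5Action121.gaugeT M 1`) of `n·Q_kA`: THE CONTOUR PART IS AN EXACT COARSE PURE GAUGE; `plaq_QconOp` —
`plaq(QconOp T A) = n·plaq(Q_kA)` at every coarse plaquette, for every `T`; `wilsonGap_QconOp` — with plaquette ANGLES read on
both lattices (B7's convention, `Q̂(0) = n`), `n^d Σ_y ‖plaq(QconOp T A)‖² − n⁴ Σ_x ‖plaq A‖² = n²·deficit A` (in `d = 4`: the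
coarse minus the fine Wilson sum with THE SAME prefactor is `n^{−2}·deficit`, ≤ 0).
§2 THE K2a SYMBOL LEMMA FOR CONTOUR AVERAGES, BY NAME.  `sum_wilsonGap_QconOp_planeWave`: on every plane wave
`A = ε ⊗ χ_{p′+l}` and for EVERY `T`, `Σ_μΣ_ν [n⁴Σ_x‖plaq A‖² − n^dΣ_y‖plaq(QconOp T A)‖²] = n²·4·n^{d+2}·#T₁·defectFormC n P ε′`
(H-1′'s `sum_neg_deficit_planeWave` transported), and `…_le`: `≤ n²·4·n^{d+2}·#T₁·((n²−1)∕12)(ΣP²)²Σ‖ε‖²` (H-1's sharp global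
quartic bound), `…_nonneg` (the Jensen sign).  So balaban-calc's Δ1 object — B7's average WITH tree contours — has the closed-form
diagonal Bloch defect of R-calc-40 §2 as a KERNEL statement, not a three-code identification.
§3 THE B5 (1.7) TREE INSTANCE.  `upperIota`, `treeSum A x j = A(Γ_{x, x+j})` along the tree of (1.7) (direction `d−1` first),
`QtreeOp A = QconOp (y j ↦ treeSum A (n·y) j) A` = the linearisation (47) of (15)∕(42) on the typed torus; `QtreeOp_const`
(`Q̂(0) = n·Id`: a constant field `a` is averaged to `n·a` — B7 reads bond ANGLES, B5's `Q_k` reads `a`); `treeSum_gaugeT`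
(telescoping along the tree: `(∂^ηλ)(Γ_{x,x+j}) = n(λ(x+j) − λ(x))`) and `QtreeOp_gaugeT`: `Q^tree(A − ∂^ηλ) = Q^treeA −
n·∂(λ ∘ up)` — the tree-contour average intertwines a fine gauge transformation with the RESTRICTION of `λ` to the coarse
lattice ((11) p. 19 linearised), whereas the straight `Q_k` produces the block MEAN `Q′_kλ` ((1.20), `QvOp_gaugeT_eq`).
WHAT IS NOT HERE.  The identification of `treeSum ∘ up` with the `ℤ^d` words `B7Prop1Explicit.treeWord`∕`gammaWord` under the
projection `ℤ^d → torus` (the companion `NE7BlockAverageContourGaugeZd` treats `B7Prop1Explicit.Tside` literally on `ℤ^d`);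
umklapp blocks and the Plancherel synthesis of the deficit over all modes; anything non-abelian or non-linear.  A contour
system whose EXIT transporter is not the reverse of its ENTRY transporter (exit corner data `S ≠ −T` — e.g. the last piece read
as a tree ROOTED AT THE FINE POINT with the same direction rule, instead of `Γ_{c₊,x(c)}` reversed) is of the TWO-SYSTEM form
`QconOp₂ T S` of the companion module `NE7BlockAverageContourGaugeTwoSystem`; its plaquettes are `n·plaq Q_k + (Ψ(y+e_μ) −
Ψ(y+e_ν))` with the loop potential `Ψ = Φ_T + Φ_S` (`plaq_QconOp₂`), and they reduce to `Q_k`'s iff `Ψ` is plaquette-closed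
(`plaq_QconOp₂_eq_iff`) — the calc lane's «SENSITIVITY» line (defect `O(|p|³)`).  [v1.1, ERRATUM E-g52-1, wording only: v1
said «a transporter system depending on the bond DIRECTION»; the fine-rooted exit piece is CORNER DATA and the mechanism is the
entry∕exit asymmetry — crux refuter, PRICING-NE7 v7 §39(c); no statement of this file changed.]
-/

noncomputable section

open Finset Complex
open scoped BigOperators Matrix ComplexConjugate

namespace Summit.QuantumFields.BalabanUV.T4Continuum.NE7BlockAverageContourGauge

open Literature.MathematicalPhysics.QuantumFieldTheory.Balaban1983to89.B5Prop11Plancherel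
open Literature.MathematicalPhysics.QuantumFieldTheory.Balaban1983to89.B5Action121
open Literature.MathematicalPhysics.QuantumFieldTheory.Balaban1983to89.B5Block118
open Literature.MathematicalPhysics.QuantumFieldTheory.Balaban1983to89.B5AverageCurlStokes
open Literature.MathematicalPhysics.QuantumFieldTheory.Balaban1983to89.T4AveragingDeficit
open Summit.QuantumFields.BalabanUV.T4Continuum.NE7BlockDefectSymbolBound
open Summit.QuantumFields.BalabanUV.T4Continuum.NE7BlockDefectSymbolStencil

variable {d : ℕ} (n : ℕ) [NeZero n] (M : Fin d → ℕ) [hM : ∀ μ, NeZero (M μ)]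

/-! ## §1 Contour averages with arbitrary corner data: an exact coarse pure gauge over `n·Q_k` -/

/-- The LINEARISED CONTOUR AVERAGE of B7 (14)–(15) ∕ (47) with corner data `T` and normalisation `n^{−d}`:
`(Q^T A)(y, μ) = n^{−d} Σ_j [T y j + A([x_j, x_j + e_μ]) − T (y + e_μ) j]`, `x_j = n·y + j` — corner contour, straight line
`[x, x(c)]`, and the corner contour of the next block REVERSED (`Γ_{x(c),c₊}`).  `T y j` stands for the linearised transporter
`A(Γ_{y,x_j})` of ANY contour system translated with the blocks. [cite: Balaban1985Averaging, (14) p.19, (47)–(48) p.25] -/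
def QconOp (T : Tor M → (Fin d → Fin n) → ℂ) (A : Tor (fine n M) × Fin d → ℂ) : Tor M × Fin d → ℂ :=
  fun b => 1 / (n : ℂ) ^ d * ∑ j : Fin d → Fin n, (T b.1 j + lineSum n M A (bpt n M b.1 j) b.2 - T (b.1 + unitVec M b.2) j)

/-- The CORNER POTENTIAL `Φ_T(y) = n^{−d} Σ_j T y j` (block mean of the corner transporters) — the coarse scalar whose
gradient the contour parts of (14) add up to. [folklore] -/
def cornerPot (T : Tor M → (Fin d → Fin n) → ℂ) : Tor M → ℂ :=
  fun y => 1 / (n : ℂ) ^ d * ∑ j : Fin d → Fin n, T y j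

omit [NeZero n] hM in
/-- Unfolding lemma for `QconOp`. [folklore] -/
theorem QconOp_apply (T : Tor M → (Fin d → Fin n) → ℂ) (A : Tor (fine n M) × Fin d → ℂ) (y : Tor M) (μ : Fin d) :
    QconOp n M T A (y, μ)
      = 1 / (n : ℂ) ^ d * ∑ j : Fin d → Fin n,
          (T y j + lineSum n M A (bpt n M y j) μ - T (y + unitVec M μ) j) := rfl

/-- **THE CONTOUR PART IS AN EXACT COARSE PURE GAUGE**: `(Q^T A)(y,μ) = n·(Q_kA)(y,μ) − (Φ_T(y + e_μ) − Φ_T(y))` with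
`Q_k` = B5 (1.18) (`QvOp`, normalisation `n^{−(d+1)}`) and `Φ_T` the corner potential. [folklore] -/
theorem QconOp_eq (T : Tor M → (Fin d → Fin n) → ℂ) (A : Tor (fine n M) × Fin d → ℂ) (y : Tor M) (μ : Fin d) :
    QconOp n M T A (y, μ)
      = (n : ℂ) * (QvOp n M *ᵥ A) (y, μ) - (cornerPot n M T (y + unitVec M μ) - cornerPot n M T y) := by
  have hn : (n : ℂ) ≠ 0 := by exact_mod_cast NeZero.ne n
  rw [QconOp_apply, QvOp_mulVec, cornerPot, cornerPot, Finset.sum_sub_distrib, Finset.sum_add_distrib]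
  field_simp
  ring

/-- Operator form: `Q^T A = (n·Q_kA)^{Φ_T}`, the coarse gauge transform (`B5Action121.gaugeT M 1`, unit coarse lattice) of
`n·Q_kA` by the corner potential. [folklore] -/
theorem QconOp_eq_gaugeT (T : Tor M → (Fin d → Fin n) → ℂ) (A : Tor (fine n M) × Fin d → ℂ) :
    QconOp n M T A = gaugeT M 1 ((n : ℂ) • (QvOp n M *ᵥ A)) (cornerPot n M T) := by
  funext ⟨y, μ⟩
  rw [QconOp_eq, gaugeT, Pi.sub_apply, Pi.smul_apply, GradOp_mulVec, sdiff_mulVec, smul_eq_mul, one_mul]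

/-- **COARSE PLAQUETTES**: `plaq(Q^T A)(y) = n·plaq(Q_kA)(y)` at every coarse plaquette and for EVERY corner-transporter
system — the contour parts cancel around `∂p′` (B7 (48), tree `B7Prop1Explicit.corner_cancellation`, here on the typed torus
and as a statement about `QvOp`). [cite: Balaban1985Averaging, (48) p.25] -/
theorem plaq_QconOp (T : Tor M → (Fin d → Fin n) → ℂ) (A : Tor (fine n M) × Fin d → ℂ) (μ ν : Fin d) (y : Tor M) :
    plaq M (QconOp n M T A) μ ν y = (n : ℂ) * plaq M (QvOp n M *ᵥ A) μ ν y := by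
  simp only [plaq_apply, QconOp_eq]
  rw [add_right_comm y (unitVec M ν) (unitVec M μ)]
  ring

/-- Squared moduli: `‖plaq(Q^T A)(y)‖² = n²·‖plaq(Q_kA)(y)‖²`. [folklore] -/
theorem normSq_plaq_QconOp (T : Tor M → (Fin d → Fin n) → ℂ) (A : Tor (fine n M) × Fin d → ℂ) (μ ν : Fin d)
    (y : Tor M) :
    ‖plaq M (QconOp n M T A) μ ν y‖ ^ 2 = (n : ℝ) ^ 2 * ‖plaq M (QvOp n M *ᵥ A) μ ν y‖ ^ 2 := by
  rw [plaq_QconOp, norm_mul, Complex.norm_natCast, mul_pow]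

/-- Summed over the coarse torus: `Σ_y ‖plaq(Q^T A)‖² = n²·Σ_y ‖plaq(Q_kA)‖²`. [folklore] -/
theorem sum_normSq_plaq_QconOp (T : Tor M → (Fin d → Fin n) → ℂ) (A : Tor (fine n M) × Fin d → ℂ) (μ ν : Fin d) :
    ∑ y : Tor M, ‖plaq M (QconOp n M T A) μ ν y‖ ^ 2
      = (n : ℝ) ^ 2 * ∑ y : Tor M, ‖plaq M (QvOp n M *ᵥ A) μ ν y‖ ^ 2 := by
  rw [Finset.mul_sum]
  exact Finset.sum_congr rfl fun y _ => normSq_plaq_QconOp n M T A μ ν y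

/-- **THE WILSON DEFICIT OF A CONTOUR AVERAGE IS `T4AveragingDeficit.deficit`**: reading `A` as fine bond ANGLES and `Q^T A`
as coarse bond angles (B7's convention: `Q̂(0) = n`), `n^d·Σ_y ‖plaq(Q^T A)‖² − n⁴·Σ_x ‖plaq A‖² = n²·deficit A` for every
`T`.  In `d = 4` the left side is `n⁴·(Σ_y ϑ′² − Σ_x ϑ²)` — coarse minus fine Wilson sum with the SAME prefactor — so that
difference is `n^{−2}·deficit ≤ 0`. [cite: Federbush1986PhaseCellI, (0.12) p.321] -/
theorem wilsonGap_QconOp (T : Tor M → (Fin d → Fin n) → ℂ) (A : Tor (fine n M) × Fin d → ℂ) (μ ν : Fin d) :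
    (n : ℝ) ^ d * ∑ y : Tor M, ‖plaq M (QconOp n M T A) μ ν y‖ ^ 2
        - (n : ℝ) ^ 4 * ∑ x : Tor (fine n M), ‖plaq (fine n M) A μ ν x‖ ^ 2
      = (n : ℝ) ^ 2 * deficit n M A μ ν := by
  rw [sum_normSq_plaq_QconOp, deficit]
  ring

/-- The sign: the coarse Wilson sum of ANY contour average is at most the fine one (Federbush ∕ Jensen, tree
`deficit_nonpos`). [cite: Federbush1986PhaseCellI, (0.12) p.321] -/
theorem wilsonGap_QconOp_nonpos (T : Tor M → (Fin d → Fin n) → ℂ) (A : Tor (fine n M) × Fin d → ℂ) (μ ν : Fin d) :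
    (n : ℝ) ^ d * ∑ y : Tor M, ‖plaq M (QconOp n M T A) μ ν y‖ ^ 2
        - (n : ℝ) ^ 4 * ∑ x : Tor (fine n M), ‖plaq (fine n M) A μ ν x‖ ^ 2 ≤ 0 := by
  rw [wilsonGap_QconOp]
  exact mul_nonpos_of_nonneg_of_nonpos (by positivity) (deficit_nonpos n M A μ ν)

/-! ## §2 The K2a abelian symbol lemma for contour averages, by name (H-1 ∕ H-1′ transported) -/

/-- **H-1″ (identity)**: on the plane wave `A = ε ⊗ χ_{p′+l}` and for EVERY corner-transporter system `T` (which may depend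
on the wave in any way), `Σ_μΣ_ν [n⁴Σ_x‖plaq A‖² − n^dΣ_y‖plaq(Q^T A)‖²] = n²·4·n^{d+2}·#T₁·defectFormC n P ε′` — H-1′'s
`sum_neg_deficit_planeWave` holds verbatim for the contour average. [folklore] -/
theorem sum_wilsonGap_QconOp_planeWave (T : Tor M → (Fin d → Fin n) → ℂ) (k : Fin d → Fin n) (q : Tor M)
    (ε : Fin d → ℂ) :
    ∑ μ, ∑ ν, ((n : ℝ) ^ 4 * ∑ x : Tor (fine n M), ‖plaq (fine n M) (planeWave n M (pOf n M (k, q)) ε) μ ν x‖ ^ 2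
        - (n : ℝ) ^ d * ∑ y : Tor M, ‖plaq M (QconOp n M T (planeWave n M (pOf n M (k, q)) ε)) μ ν y‖ ^ 2)
      = (n : ℝ) ^ 2 * (4 * ((n : ℝ) ^ (d + 2) * Fintype.card (Tor M))
          * defectFormC n (angle n M k q) (twist (angle n M k q) ε)) := by
  rw [← sum_neg_deficit_planeWave, Finset.mul_sum]
  refine Finset.sum_congr rfl fun μ _ => ?_
  rw [Finset.mul_sum]
  refine Finset.sum_congr rfl fun ν _ => ?_
  rw [mul_neg, ← wilsonGap_QconOp n M T]
  ring

/-- **H-1″ (bound)**: `… ≤ n²·4·n^{d+2}·#T₁·((n²−1)∕12)·(ΣP²)²·Σ‖ε‖²` — H-1's SHARP global quartic bound for the Wilson defect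
of B7's linearised contour average, every `T`, every momentum. [folklore] -/
theorem sum_wilsonGap_QconOp_planeWave_le (T : Tor M → (Fin d → Fin n) → ℂ) (k : Fin d → Fin n) (q : Tor M)
    (ε : Fin d → ℂ) :
    ∑ μ, ∑ ν, ((n : ℝ) ^ 4 * ∑ x : Tor (fine n M), ‖plaq (fine n M) (planeWave n M (pOf n M (k, q)) ε) μ ν x‖ ^ 2
        - (n : ℝ) ^ d * ∑ y : Tor M, ‖plaq M (QconOp n M T (planeWave n M (pOf n M (k, q)) ε)) μ ν y‖ ^ 2)
      ≤ (n : ℝ) ^ 2 * (4 * ((n : ℝ) ^ (d + 2) * Fintype.card (Tor M))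
          * (((n : ℝ) ^ 2 - 1) / 12 * (∑ l, angle n M k q l ^ 2) ^ 2 * ∑ κ, ‖ε κ‖ ^ 2)) := by
  rw [sum_wilsonGap_QconOp_planeWave]
  have h := sum_neg_deficit_planeWave_le n M k q ε
  rw [sum_neg_deficit_planeWave] at h
  exact mul_le_mul_of_nonneg_left h (by positivity)

/-- **H-1″ (sign)**: the summed Wilson defect of a contour average is `≥ 0` on every field (not only plane waves).
[folklore] -/
theorem sum_wilsonGap_QconOp_nonneg (T : Tor M → (Fin d → Fin n) → ℂ) (A : Tor (fine n M) × Fin d → ℂ) :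
    0 ≤ ∑ μ, ∑ ν, ((n : ℝ) ^ 4 * ∑ x : Tor (fine n M), ‖plaq (fine n M) A μ ν x‖ ^ 2
        - (n : ℝ) ^ d * ∑ y : Tor M, ‖plaq M (QconOp n M T A) μ ν y‖ ^ 2) := by
  refine Finset.sum_nonneg fun μ _ => Finset.sum_nonneg fun ν _ => ?_
  have h := wilsonGap_QconOp_nonpos n M T A μ ν
  linarith

/-! ## §3 The B5 (1.7) tree instance: `Q̂(0) = n·Id` and the restriction covariance (11) -/

/-- The digits of the block offset `j` in the directions ABOVE `ν` — the part of the tree contour `Γ_{x, x+j}` of B5 (1.7)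
already walked when the segment in direction `ν` starts («from `y` the `d`-th coordinate is changed first, the first
coordinate last»). [cite: Balaban1984PropagatorsI, (1.7) p.18] -/
def upperIota (j : Fin d → Fin n) (ν : ℕ) : Tor (fine n M) :=
  fun l => if ν < (l : ℕ) + 1 then ((j l : ℕ) : ZMod (fine n M l)) else 0

/-- The LINEARISED TREE TRANSPORTER `A(Γ_{x, x+j}) = Σ_ν Σ_{t < j_ν} A(x + j_{>ν} + t e_ν, ν)` along the tree contour of
B5 (1.7) from `x` to `x + j` (fine bonds of the typed torus). [cite: Balaban1984PropagatorsI, (1.7) p.18] -/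
def treeSum (A : Tor (fine n M) × Fin d → ℂ) (x : Tor (fine n M)) (j : Fin d → Fin n) : ℂ :=
  ∑ ν : Fin d, ∑ t ∈ Finset.range (j ν), A (x + upperIota n M j ((ν : ℕ) + 1) + tstep (fine n M) ν t, ν)

/-- **B7 (14)–(15) LINEARISED ON THE TYPED TORUS** ((47) p. 25: `Σ_{x∈B(c₋)} L^{−d} A(Γ_{c,x})`) with the B5 (1.7) trees as
corner contours and `Γ_{x(c),c₊}` the reversed tree of the next block (as in `B7Prop1Explicit.gammaWord`).
[cite: Balaban1985Averaging, (14)–(15) p.19, (47) p.25] -/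
def QtreeOp (A : Tor (fine n M) × Fin d → ℂ) : Tor M × Fin d → ℂ :=
  QconOp n M (fun y j => treeSum n M A (up n M y) j) A

/-- `Q^tree` is a contour average: all of §1–§2 apply (`T = treeSum A ∘ up`). [folklore] -/
theorem QtreeOp_eq (A : Tor (fine n M) × Fin d → ℂ) (y : Tor M) (μ : Fin d) :
    QtreeOp n M A (y, μ)
      = (n : ℂ) * (QvOp n M *ᵥ A) (y, μ)
        - (cornerPot n M (fun y j => treeSum n M A (up n M y) j) (y + unitVec M μ)
            - cornerPot n M (fun y j => treeSum n M A (up n M y) j) y) :=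
  QconOp_eq n M _ A y μ

/-- `plaq(Q^tree A) = n·plaq(Q_kA)`. [cite: Balaban1985Averaging, (48) p.25] -/
theorem plaq_QtreeOp (A : Tor (fine n M) × Fin d → ℂ) (μ ν : Fin d) (y : Tor M) :
    plaq M (QtreeOp n M A) μ ν y = (n : ℂ) * plaq M (QvOp n M *ᵥ A) μ ν y :=
  plaq_QconOp n M _ A μ ν y

/-- The Wilson deficit of the tree-contour average is `n²·deficit`. [folklore] -/
theorem wilsonGap_QtreeOp (A : Tor (fine n M) × Fin d → ℂ) (μ ν : Fin d) :
    (n : ℝ) ^ d * ∑ y : Tor M, ‖plaq M (QtreeOp n M A) μ ν y‖ ^ 2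
        - (n : ℝ) ^ 4 * ∑ x : Tor (fine n M), ‖plaq (fine n M) A μ ν x‖ ^ 2
      = (n : ℝ) ^ 2 * deficit n M A μ ν :=
  wilsonGap_QconOp n M _ A μ ν

omit [NeZero n] hM in
/-- The tree transporter of a direction-wise CONSTANT field does not depend on the base point. [folklore] -/
theorem treeSum_const (a : Fin d → ℂ) (x x' : Tor (fine n M)) (j : Fin d → Fin n) :
    treeSum n M (fun i => a i.2) x j = treeSum n M (fun i => a i.2) x' j := rfl

omit [NeZero n] hM in
/-- The straight line sum of a direction-wise constant field: `a([x, x + e_μ]) = n·a_μ`. [folklore] -/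
theorem lineSum_const (a : Fin d → ℂ) (x : Tor (fine n M)) (μ : Fin d) :
    lineSum n M (fun i => a i.2) x μ = (n : ℂ) * a μ := by
  simp [lineSum]

omit hM in
/-- **`Q̂(0) = n·Id`**: the tree-contour average of a direction-wise constant field `a` is `n·a` (B7 averages bond ANGLES:
a coarse bond carries `n` fine ones), whereas B5's `Q_k` gives `a` (normalisation `η^{d+1}`). [folklore] -/
theorem QtreeOp_const (a : Fin d → ℂ) (y : Tor M) (μ : Fin d) :
    QtreeOp n M (fun i => a i.2) (y, μ) = (n : ℂ) * a μ := by
  have hn : (n : ℂ) ≠ 0 := by exact_mod_cast NeZero.ne n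
  have h : ∀ j : Fin d → Fin n,
      treeSum n M (fun i => a i.2) (up n M y) j + lineSum n M (fun i => a i.2) (bpt n M y j) μ
        - treeSum n M (fun i => a i.2) (up n M (y + unitVec M μ)) j = (n : ℂ) * a μ := by
    intro j
    rw [lineSum_const, treeSum_const n M a (up n M (y + unitVec M μ)) (up n M y)]
    ring
  rw [QtreeOp, QconOp_apply, Finset.sum_congr rfl fun j _ => h j, Finset.sum_const, Finset.card_univ,
    Fintype.card_fun, Fintype.card_fin, Fintype.card_fin, nsmul_eq_mul, Nat.cast_pow]
  field_simp

omit [NeZero n] hM in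
/-- `upperIota j 0 = j` (all digits). [folklore] -/
theorem upperIota_zero (j : Fin d → Fin n) : upperIota n M j 0 = iota n M j := by
  funext l
  simp [upperIota, iota]

omit [NeZero n] hM in
/-- `upperIota j d = 0` (no digit). [folklore] -/
theorem upperIota_d (j : Fin d → Fin n) : upperIota n M j d = 0 := by
  funext l
  have : ¬ d < (l : ℕ) + 1 := by have := l.isLt; omega
  simp [upperIota, this]

omit [NeZero n] hM in
/-- One tree level: `j_{>ν−1} = j_{>ν} + j_ν e_ν`, i.e. `upperIota j ν = upperIota j (ν+1) + tstep ν (j ν)`. [folklore] -/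
theorem upperIota_succ (j : Fin d → Fin n) (ν : Fin d) :
    upperIota n M j (ν : ℕ) = upperIota n M j ((ν : ℕ) + 1) + tstep (fine n M) ν (j ν) := by
  funext l
  by_cases h : l = ν
  · subst h
    simp [upperIota, tstep]
  · have hne : (l : ℕ) ≠ (ν : ℕ) := fun h' => h (Fin.ext h')
    have hiff : ((ν : ℕ) < (l : ℕ) + 1) ↔ ((ν : ℕ) + 1 < (l : ℕ) + 1) := by omega
    simp only [upperIota, tstep, Pi.add_apply, if_neg h, add_zero]
    by_cases h1 : (ν : ℕ) < (l : ℕ) + 1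
    · rw [if_pos h1, if_pos (hiff.mp h1)]
    · rw [if_neg h1, if_neg (fun h2 => h1 (hiff.mpr h2))]

/-- **Telescoping along the tree**: for the fine gradient `∂^ηλ` (lattice factor `n = η⁻¹`),
`(∂^ηλ)(Γ_{x,x+j}) = n·(λ(x + j) − λ(x))`; hence `treeSum (A − ∂^ηλ) x j = treeSum A x j − n(λ(x+j) − λ(x))`. [folklore] -/
theorem treeSum_gaugeT (A : Tor (fine n M) × Fin d → ℂ) (l : Tor (fine n M) → ℂ) (x : Tor (fine n M))
    (j : Fin d → Fin n) :
    treeSum n M (gaugeT (fine n M) (n : ℂ) A l) x j = treeSum n M A x j - (n : ℂ) * (l (x + iota n M j) - l x) := by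
  -- each tree level telescopes along its segment
  have hlev : ∀ ν : Fin d, ∑ t ∈ Finset.range (j ν),
      gaugeT (fine n M) (n : ℂ) A l (x + upperIota n M j ((ν : ℕ) + 1) + tstep (fine n M) ν t, ν)
      = (∑ t ∈ Finset.range (j ν), A (x + upperIota n M j ((ν : ℕ) + 1) + tstep (fine n M) ν t, ν))
        - (n : ℂ) * (l (x + upperIota n M j (ν : ℕ)) - l (x + upperIota n M j ((ν : ℕ) + 1))) := by
    intro ν
    have ht := Finset.sum_range_sub (fun t => l (x + upperIota n M j ((ν : ℕ) + 1) + tstep (fine n M) ν t)) (j ν)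
    simp only [gaugeT, Pi.sub_apply, GradOp_mulVec, sdiff_mulVec]
    rw [Finset.sum_sub_distrib, ← Finset.mul_sum]
    congr 2
    simp only [tstep_succ, ← add_assoc] at ht
    rw [ht, tstep_zero, add_zero, upperIota_succ, ← add_assoc]
  unfold treeSum
  rw [Finset.sum_congr rfl fun ν _ => hlev ν, Finset.sum_sub_distrib, ← Finset.mul_sum]
  congr 2
  -- the levels telescope from `upperIota j d = 0` to `upperIota j 0 = j`
  have htel := Finset.sum_range_sub' (fun i => l (x + upperIota n M j i)) d
  rw [← Fin.sum_univ_eq_sum_range (fun i => l (x + upperIota n M j i) - l (x + upperIota n M j (i + 1))) d] at htel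
  rw [htel, upperIota_zero, upperIota_d, add_zero]

/-- **RESTRICTION COVARIANCE of the tree-contour average** (B7 (11) p. 19 `\bar{U^u} = Ū^u`, linearised): for a fine
gauge transformation `A ↦ A − ∂^ηλ` the tree-contour average changes by the COARSE gradient of the RESTRICTION `λ ∘ up` of
`λ` to the block corners (times the angle factor `n`): `Q^tree(A − ∂^ηλ)(y,μ) = Q^treeA(y,μ) − n(λ(n(y+e_μ)) − λ(ny))` —
contrast B5 (1.20) for the straight `Q_k`, where the block MEAN `Q′_kλ` appears (`B5Block118.QvOp_gaugeT`).
[cite: Balaban1985Averaging, (11) p.19; Balaban1984PropagatorsI, (1.20) p.20] -/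
theorem QtreeOp_gaugeT (A : Tor (fine n M) × Fin d → ℂ) (l : Tor (fine n M) → ℂ) (y : Tor M) (μ : Fin d) :
    QtreeOp n M (gaugeT (fine n M) (n : ℂ) A l) (y, μ)
      = QtreeOp n M A (y, μ) - (n : ℂ) * (l (up n M (y + unitVec M μ)) - l (up n M y)) := by
  have hn : (n : ℂ) ≠ 0 := by exact_mod_cast NeZero.ne n
  rw [QtreeOp, QtreeOp, QconOp_apply, QconOp_apply]
  simp only [treeSum_gaugeT, lineSum_gaugeT, bpt_add_tstep]
  have hb : ∀ (z : Tor M) (j : Fin d → Fin n), up n M z + iota n M j = bpt n M z j := fun z j => rfl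
  simp only [hb]
  have hsum : ∑ j : Fin d → Fin n,
      (treeSum n M A (up n M y) j - (n : ℂ) * (l (bpt n M y j) - l (up n M y))
        + (lineSum n M A (bpt n M y j) μ - (n : ℂ) * (l (bpt n M (y + unitVec M μ) j) - l (bpt n M y j)))
        - (treeSum n M A (up n M (y + unitVec M μ)) j
            - (n : ℂ) * (l (bpt n M (y + unitVec M μ) j) - l (up n M (y + unitVec M μ)))))
      = (∑ j : Fin d → Fin n, (treeSum n M A (up n M y) j + lineSum n M A (bpt n M y j) μ
          - treeSum n M A (up n M (y + unitVec M μ)) j))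
        - ∑ _j : Fin d → Fin n, (n : ℂ) * (l (up n M (y + unitVec M μ)) - l (up n M y)) := by
    rw [← Finset.sum_sub_distrib]
    exact Finset.sum_congr rfl fun j _ => by ring
  rw [hsum, Finset.sum_const, Finset.card_univ, Fintype.card_fun, Fintype.card_fin, Fintype.card_fin, nsmul_eq_mul,
    Nat.cast_pow, mul_sub]
  congr 1
  field_simp

end Summit.QuantumFields.BalabanUV.T4Continuum.NE7BlockAverageContourGauge

end
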